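import Summits.FinalStateConjecture.FinalStateConjecture.Theorems.BartnikGapSettlingBondiBartnikRigidityKillingPropagationFutureDomain
import HarnessLib

/-!
# The interior of the Killing domain is causally convex, and its entry points lie on the initial
# boundary — bricks for the Killing PROPAGATION step β' (`stub_killingPropagation'`, K1a) of the
# line `direct-method-on-the-cone`, crux `BondiBartnikRigidity` (stmt-FinalStateConjecture-10807);
# worker betaA of lead c3

Continuation of `…KillingPropagationFutureDomain.lean` (causal bookkeeping (G0)/(G1a) of the
Killing domain `D⁺(C ∪ N_out)` of a thick collar core `C ⊆ ι(X)`, FAITHFUL `futureDomain`):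

* `causallyConvex_interior_killingDomain` — `G = (killingDomain)°` is causally convex in `𝒱`
  (`J⁺(x) ∩ J⁻(q) ⊆ G` for `x, q ∈ G`), so that open past sets of `G` are causally convex and
  hence globally hyperbolic sub-spacetimes (`…KillingPropagationPastSet.lean`);
* `mem_initialBoundary_of_entry` — ENTRY POINTS LIE ON `S`: a point `z ∈ closure G ∖ G`
  chronologically before a point of `G` (e.g. the past endpoint of a future timelike curve
  running in `G`) lies in `S = C ∪ N_out`; registered brick
  `stub_killingPropagation_entryPointsOnBoundary` (signature verbatim).  This is the half (G1a)
  of the Cauchy-hypersurface step of β' which the tree's causality theory reaches; the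
  complementary generator statement at roof entry points is the displayed hypothesis of the
  conditional closer `…KillingPropagationOfFacts.lean`.

Everything is proved; no definitions, no named facts.  References: Hawking–Ellis 1973, §6.5–6.6
[HawkingEllis1973CUP]; O'Neill 1983, Ch. 14, Cor. 14.1, Def. 14.28, Prop. 14.31
[ONeillSemiRiemannian1983].
-/

noncomputable section

-- D-0017: single-problem summit, `Summit.<S>.<S>.…` by design (cf. lakefile `weak.linter.dupNamespace`).
set_option linter.dupNamespace false

open Set Filter Function Topology TopologicalSpace
open Literature.Geometry.Lorentzian
open scoped Manifold ContDiff Topology ENNReal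

namespace Summit.FinalStateConjecture.FinalStateConjecture.Theorems.BondiBartnikRigidity.DirectMethod

namespace KillingPropagation

universe u

section Development

variable {X : Type u} [TopologicalSpace X] [ChartedSpace E3 X] [IsManifold (𝓡 3) ∞ X]
  [ConnectedSpace X] {D : InitialDataSet (𝓡 3) X}

/-- **The interior `G` of the Killing domain is causally convex**: for `x, q ∈ G` and
`x ≤ y ≤ q`, pick `x⁻ ≪ x` and `q ≪ q⁺` in the open set `G` (`p ∈ cl I±(p)`); the open
neighbourhood `I⁺(x⁻) ∩ I⁻(q⁺)` of `y` lies in `I⁺(S)` (`x⁻ ∈ G ⊆ J⁺(S)`, push-up) and below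
`q⁺ ∈ D⁺(S)`, hence in `D⁺(S)` (`mem_futureDomain_of_mem_causalPast`, `S` achronal), so
`y ∈ G`. Hawking–Ellis 1973, §6.5–6.6. [cite: HawkingEllis1973CUP, §6.5] -/
theorem causallyConvex_interior_killingDomain (𝒱 : VacuumCauchyDevelopment D) (M : Fin 1 → ℝ)
    (p : 𝒱.carrier) (B : Fin 1 → ModelBackground) (Φ : ∀ i, (B i).domain → 𝒱.carrier)
    (hCX : collarCore M p B Φ ⊆ range 𝒱.embed) :
    ∀ x ∈ interior (killingDomain 𝒱 M p B Φ), ∀ q ∈ interior (killingDomain 𝒱 M p B Φ),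
      𝒱.metric.causalFuture 𝒱.timeOrientation {x} ∩ 𝒱.metric.causalPast 𝒱.timeOrientation {q} ⊆
        interior (killingDomain 𝒱 M p B Φ) := by
  intro x hx q hq y hy
  set g := 𝒱.metric
  set τ := 𝒱.timeOrientation
  set C := collarCore M p B Φ with hC
  set S : Set 𝒱.carrier := C ∪ (frontier (g.causalFuture τ C) ∩
    g.causalFuture τ (Φ 0 '' shellSlab (B 0) (M 0))) with hS
  have hn2 : (2 : ℕ∞ω) ≤ ((⊤ : ℕ∞) : ℕ∞ω) := WithTop.coe_le_coe.mpr le_top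
  have hn1 : (1 : ℕ∞ω) ≤ ((⊤ : ℕ∞) : ℕ∞ω) := le_trans one_le_two hn2
  have hkD : killingDomain 𝒱 M p B Φ = futureDomain 𝒱.toSpacetime S := rfl
  have hSach := chronologicalFuture_inter_initialBoundary_eq_empty 𝒱 M p B Φ hCX
  -- `x⁻ ≪ x` and `q ≪ q⁺` inside `G`
  have hclq : q ∈ closure (g.chronologicalFuture τ {q}) :=
    g.mem_closure_chronologicalFuture_self τ BoundarylessManifold.isInteriorPoint
  obtain ⟨qp, hqpG, hqqp⟩ := mem_closure_iff_nhds.mp hclq _ (isOpen_interior.mem_nhds hq)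
  have hclx : x ∈ closure (g.chronologicalPast τ {x}) :=
    g.mem_closure_chronologicalFuture_self τ.reverse BoundarylessManifold.isInteriorPoint
  obtain ⟨xm, hxmG, hxxm⟩ := mem_closure_iff_nhds.mp hclx _ (isOpen_interior.mem_nhds hx)
  have hxmx : x ∈ g.chronologicalFuture τ {xm} :=
    LorentzianMetric.mem_chronologicalFuture_of_mem_chronologicalPast hxxm
  -- the open neighbourhood `N = I⁺(x⁻) ∩ I⁻(q⁺)` of `y`
  set N : Set 𝒱.carrier := g.chronologicalFuture τ {xm} ∩ g.chronologicalPast τ {qp} with hN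
  have hNo : IsOpen N := (LorentzianMetric.isOpen_chronologicalFuture_of_boundaryless g τ _).inter
    (LorentzianMetric.isOpen_chronologicalPast_of_boundaryless g τ _)
  have hyN : y ∈ N := by
    refine ⟨?_, ?_⟩
    · -- `xm ≪ x ≤ y`
      exact LorentzianMetric.mem_chronologicalFuture_of_mem_chronologicalFuture_of_mem_causalFuture_set
        hn1 hxmx hy.1
    · -- `y ≤ q ≪ qp`
      exact LorentzianMetric.mem_chronologicalPast_of_mem_chronologicalFuture
        (LorentzianMetric.mem_chronologicalFuture_of_mem_causalFuture hn1
          (LorentzianMetric.mem_causalPast_singleton_iff.1 hy.2) hqqp)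
  -- `N ⊆ D⁺(S)`
  have hNsub : N ⊆ killingDomain 𝒱 M p B Φ := by
    intro y' hy'
    have hxmJ : xm ∈ g.causalFuture τ S :=
      futureDomain_subset_causalFuture 𝒱.toSpacetime S (interior_subset hxmG)
    have hy'I : y' ∈ g.chronologicalFuture τ S := by
      have : y' ∈ g.chronologicalFuture τ (g.causalFuture τ S) := by
        rw [LorentzianMetric.chronologicalFuture_eq_biUnion]
        simp only [mem_iUnion, exists_prop]
        exact ⟨xm, hxmJ, hy'.1⟩
      rwa [LorentzianMetric.chronologicalFuture_causalFuture_eq_of_boundaryless hn1] at this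
    have hy'qp : qp ∈ g.causalFuture τ {y'} :=
      LorentzianMetric.chronologicalFuture_subset_causalFuture g τ _
        (LorentzianMetric.mem_chronologicalFuture_of_mem_chronologicalPast hy'.2)
    rw [hkD]
    exact mem_futureDomain_of_mem_causalPast 𝒱.toSpacetime hSach (interior_subset hqpG) hy'I hy'qp
  exact interior_maximal hNsub hNo hyN

/-- **Entry points of the Killing domain lie on the initial boundary.** If `z ∈ closure G ∖ G`
is chronologically before a point `y ∈ G` (e.g. `z` is the past endpoint of a future timelike
curve running in `G`), then `z ∈ S = C ∪ N_out`. Extend a timelike segment from `z` to `y` to an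
endless timelike curve `Δ` (O'Neill 1983, Def. 14.28/Prop. 14.31); as `y ∈ D⁺(S)`, `Δ` meets `S`
at or before `y`: AT `z` (the claim), or strictly between `z` and `y` at `n ≫ z` — impossible, as
`n ∈ C ⊆ ι(X)` would put `z ∈ closure G ⊆ J⁺(ι X)` into `I⁻(ι X)`, and `n ∈ N_out ⊆ ∂J⁺(C)`
would lie in `I⁺(closure J⁺ C) = I⁺(C) ⊆ (J⁺ C)°` —, or strictly before `z` at `m ≪ z`, which
puts `z` in the open set `I⁺(S) ∩ I⁻(y⁺)` (`y ≪ y⁺ ∈ G`), a subset of `D⁺(S)` by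
`mem_futureDomain_of_mem_causalPast`, i.e. `z ∈ G` — impossible. Hawking–Ellis 1973, §6.5.
[cite: HawkingEllis1973CUP, §6.5] -/
theorem mem_initialBoundary_of_entry (𝒱 : VacuumCauchyDevelopment D) (M : Fin 1 → ℝ)
    (p : 𝒱.carrier) (B : Fin 1 → ModelBackground) (Φ : ∀ i, (B i).domain → 𝒱.carrier)
    (hCX : collarCore M p B Φ ⊆ range 𝒱.embed) {z y : 𝒱.carrier}
    (hz : z ∈ closure (interior (killingDomain 𝒱 M p B Φ)))
    (hzG : z ∉ interior (killingDomain 𝒱 M p B Φ)) (hy : y ∈ interior (killingDomain 𝒱 M p B Φ))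
    (hzy : y ∈ 𝒱.metric.chronologicalFuture 𝒱.timeOrientation {z}) :
    z ∈ collarCore M p B Φ ∪
      (frontier (𝒱.metric.causalFuture 𝒱.timeOrientation (collarCore M p B Φ)) ∩
        𝒱.metric.causalFuture 𝒱.timeOrientation (Φ 0 '' shellSlab (B 0) (M 0))) := by
  set g := 𝒱.metric
  set τ := 𝒱.timeOrientation
  set C := collarCore M p B Φ with hC
  set S : Set 𝒱.carrier := C ∪ (frontier (g.causalFuture τ C) ∩
    g.causalFuture τ (Φ 0 '' shellSlab (B 0) (M 0))) with hS
  set G : Set 𝒱.carrier := interior (killingDomain 𝒱 M p B Φ) with hG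
  have hn2 : (2 : ℕ∞ω) ≤ ((⊤ : ℕ∞) : ℕ∞ω) := WithTop.coe_le_coe.mpr le_top
  have hn1 : (1 : ℕ∞ω) ≤ ((⊤ : ℕ∞) : ℕ∞ω) := le_trans one_le_two hn2
  have hkD : killingDomain 𝒱 M p B Φ = futureDomain 𝒱.toSpacetime S := rfl
  have hSach := chronologicalFuture_inter_initialBoundary_eq_empty 𝒱 M p B Φ hCX
  have hGJ : G ⊆ g.causalFuture τ C := interior_subset.trans (killingDomain_subset_causalFuture 𝒱 M p B Φ)
  have hzR : z ∈ g.causalFuture τ (range 𝒱.embed) :=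
    closure_interior_killingDomain_subset 𝒱 M p B Φ hCX hz
  have hzJ : z ∈ closure (g.causalFuture τ C) := closure_mono hGJ hz
  -- `n ≫ z` cannot lie in `S`
  have hnoS : ∀ n ∈ g.chronologicalFuture τ {z}, n ∉ S := by
    rintro n hn (hnC | ⟨hnfr, -⟩)
    · have hzI : z ∈ g.chronologicalPast τ (range 𝒱.embed) :=
        LorentzianMetric.chronologicalFuture_mono (singleton_subset_iff.2 (hCX hnC))
          (LorentzianMetric.mem_chronologicalPast_of_mem_chronologicalFuture hn)
      exact Set.disjoint_left.1
        (LorentzianMetric.IsCauchyHypersurface.disjoint_causalFuture_chronologicalPast hn2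
          𝒱.isCauchyHypersurface) hzR hzI
    · have hzn : z ∈ g.chronologicalPast τ {n} :=
        LorentzianMetric.mem_chronologicalPast_of_mem_chronologicalFuture hn
      obtain ⟨w, hwP, hwJ⟩ := mem_closure_iff_nhds.mp hzJ _
        ((LorentzianMetric.isOpen_chronologicalPast_of_boundaryless g τ {n}).mem_nhds hzn)
      rw [LorentzianMetric.causalFuture_eq_biUnion] at hwJ
      simp only [mem_iUnion, exists_prop] at hwJ
      obtain ⟨c, hcC, hwc⟩ := hwJ
      have hnI : n ∈ g.chronologicalFuture τ C :=
        LorentzianMetric.chronologicalFuture_mono (singleton_subset_iff.2 hcC)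
          (LorentzianMetric.mem_chronologicalFuture_of_mem_causalFuture hn1 hwc
            (LorentzianMetric.mem_chronologicalFuture_of_mem_chronologicalPast hwP))
      exact hnfr.2 (interior_maximal (LorentzianMetric.chronologicalFuture_subset_causalFuture g τ C)
        (LorentzianMetric.isOpen_chronologicalFuture_of_boundaryless g τ C) hnI)
  -- `z ∈ I⁺(S)` is impossible: it would force `z ∈ G`
  have hnoI : z ∉ g.chronologicalFuture τ S := by
    intro hzI
    have hcly : y ∈ closure (g.chronologicalFuture τ {y}) :=
      g.mem_closure_chronologicalFuture_self τ BoundarylessManifold.isInteriorPoint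
    obtain ⟨yp, hypG, hyyp⟩ := mem_closure_iff_nhds.mp hcly _ (isOpen_interior.mem_nhds hy)
    set N : Set 𝒱.carrier := g.chronologicalFuture τ S ∩ g.chronologicalPast τ {yp} with hN
    have hNo : IsOpen N := (LorentzianMetric.isOpen_chronologicalFuture_of_boundaryless g τ _).inter
      (LorentzianMetric.isOpen_chronologicalPast_of_boundaryless g τ _)
    have hzN : z ∈ N := ⟨hzI, LorentzianMetric.mem_chronologicalPast_of_mem_chronologicalFuture
      (LorentzianMetric.mem_chronologicalFuture_trans hzy hyyp)⟩
    have hNsub : N ⊆ killingDomain 𝒱 M p B Φ := by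
      intro z' hz'
      rw [hkD]
      exact mem_futureDomain_of_mem_causalPast 𝒱.toSpacetime hSach (interior_subset hypG) hz'.1
        (LorentzianMetric.chronologicalFuture_subset_causalFuture g τ _
          (LorentzianMetric.mem_chronologicalFuture_of_mem_chronologicalPast hz'.2))
    exact hzG (interior_maximal hNsub hNo hzN)
  -- the endless extension of a timelike segment from `z` to `y`
  obtain ⟨z', hz', σ, a, b, hab, hσ, hσa, hσb⟩ := hzy
  rw [mem_singleton_iff] at hz'
  obtain ⟨Δ, Dm, hΔ, haD, hbD, hΔa, hΔb⟩ :=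
    LorentzianMetric.exists_isEndlessTimelikeCurve_extends hn2 hab hσ
  rw [hσa, hz'] at hΔa
  rw [hσb] at hΔb
  have hyD : y ∈ killingDomain 𝒱 M p B Φ := interior_subset hy
  obtain ⟨t, htD, htb, htS⟩ := hyD Δ Dm hΔ.1 hΔ.2.1.isFutureCausalCurveOn hΔ.2.2.2 b hbD hΔb
  rcases lt_trichotomy t a with hta | rfl | hta
  · -- before `z`: `Δ t ≪ z`, so `z ∈ I⁺(S)`
    exfalso
    refine hnoI ⟨Δ t, htS, Δ, t, a, hta, hΔ.2.1.mono (hΔ.1.out htD haD), rfl, hΔa⟩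
  · rw [← hΔa]; exact htS
  · -- after `z`: `z ≪ Δ t ∈ S`
    exfalso
    exact hnoS (Δ t) ⟨z, rfl, Δ, a, t, hta, hΔ.2.1.mono (hΔ.1.out haD htD), hΔa, rfl⟩ htS


end Development

end KillingPropagation

open KillingPropagation in
/-- **Registered brick `stub_killingPropagation_entryPointsOnBoundary` of
`stub_killingPropagation'` (K1a β')**: entry points of the interior of the Killing domain of a
thick collar core on the data hypersurface lie on the initial boundary `C ∪ N_out`
(instance of `mem_initialBoundary_of_entry`). [cite: HawkingEllis1973CUP, §6.5] -/
theorem stub_killingPropagation_entryPointsOnBoundary : ∀ (X : Type) [TopologicalSpace X] [ChartedSpace E3 X] [IsManifold (𝓡 3) ∞ X] [T2Space X] [SecondCountableTopology X] [ConnectedSpace X] (D : InitialDataSet (𝓡 3) X) (𝒱 : VacuumCauchyDevelopment D) (M : Fin 1 → ℝ) (p : 𝒱.carrier) (B : Fin 1 → ModelBackground) (Φ : ∀ i, (B i).domain → 𝒱.carrier) (z y : 𝒱.carrier), collarCore M p B Φ ⊆ range 𝒱.embed → z ∈ closure (interior (killingDomain 𝒱 M p B Φ)) → z ∉ interior (killingDomain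 𝒱 M p B Φ) → y ∈ interior (killingDomain 𝒱 M p B Φ) → y ∈ 𝒱.metric.chronologicalFuture 𝒱.timeOrientation {z} → z ∈ collarCore M p B Φ ∪ (frontier (𝒱.metric.causalFuture 𝒱.timeOrientation (collarCore M p B Φ)) ∩ 𝒱.metric.causalFuture 𝒱.timeOrientation (Φ 0 '' shellSlab (B 0) (M 0))) :=
  fun _ _ _ _ _ _ _ _ 𝒱 M p B Φ _ _ hCX hz hzG hy hzy ↦
    mem_initialBoundary_of_entry 𝒱 M p B Φ hCX hz hzG hy hzy

end Summit.FinalStateConjecture.FinalStateConjecture.Theorems.BondiBartnikRigidity.DirectMethod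

end
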